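import Literature.NumberTheory.GaloisRepresentations.GaloisSubgroups
import Literature.NumberTheory.GaloisRepresentations.LocalConstancy
import Literature.NumberTheory.GaloisRepresentations.ShapiroInjective
import Literature.NumberTheory.GaloisRepresentations.RestrictionCalculus
import Mathlib.Topology.Algebra.IsUniformGroup.DiscreteSubgroup
import Mathlib.FieldTheory.Fixed
import HarnessLib

/-!
# `H¹ = H² = 0` for the additive group `K̄` over open subgroups of `Γ_k` (Serre II §1.2 Prop. 1)

For a field `k` with algebraic closure `K̄` and absolute Galois group `Γ_k`, the additive group
`K̄` is a discrete `Γ_k`-module (`addRep k`), and for every **open** subgroup `H ≤ Γ_k`: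

* `subsingleton_one_addRep` — `H¹(H, K̄) = 0`;
* `subsingleton_two_addRep` — `H²(H, K̄) = 0`.

Serre (*Cohomologie galoisienne* II §1.2 Prop. 1; *Corps locaux* X §1 Prop. 1) proves
`H^q(Gal(K/k), K) = 0`, `q ≥ 1`, for finite Galois `K/k` from the normal basis theorem and passes
to the limit.  Here, without limits: a cocycle of `H` dies on `Gal(K̄/L)` for a small finite Galois
`L/k` (`exists_nhds_one_res_one_eq_zero`, `exists_nhds_one_res_two_eq_d`); by
inflation–restriction (`exists_d_eq_of_res_eq_d_one`, `exists_d_eq_of_res_eq_d_two`) it then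
comes from the finite group `Q = H / Gal(K̄/L)` acting on the fixed field `B = K̄^{Gal(K̄/L)}`,
whose
cohomology in degrees `1, 2` vanishes by averaging against an element `θ ∈ B` of trace one
(`FiniteGroupAveraging`; `θ` exists by Dedekind's independence of the automorphisms of `B`
induced by `Q`, `exists_traceOne`).  This is the input of the Artin–Schreier step of Serre II §2.2
Prop. 3 / §3.1 Prop. 5 towards
`Literature.NumberTheory.GaloisRepresentations.tsen_fieldCdLE_one_of_trdeg_eq_one`.

## References

* J.-P. Serre, *Cohomologie galoisienne* (1997), II §1.2 Prop. 1, II §2.2 Prop. 3.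
  [SerreGaloisCohomology1997]
* J.-P. Serre, *Corps locaux* (1968), X §1 Prop. 1. [SerreLocalFields1979]
-/

noncomputable section

open CategoryTheory Topology Filter Field IntermediateField

universe u

namespace Literature.NumberTheory.GaloisRepresentations

open _root_.TopRep _root_.ContRepresentation _root_.ContinuousCohomology LocalWeilDatum

set_option allowUnsafeReducibility true in
attribute [local reducible] CategoryTheory.Functor.mapHomologicalComplex

attribute [local instance] compactSpace_of_isClosed_subgroup

/-! ### The discrete `Γ_k`-module `K̄` (additive group) -/

section AddRep

variable (k : Type u) [Field k]

/-- The carrier `K̄` of the additive Galois module, an H21 type synonym carrying the **discrete**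
topology (as for `DiscreteGaloisModule.UnitsCarrier`, to avoid the normed topologies Mathlib puts
on some algebraic closures). [cite: SerreGaloisCohomology1997, II §1.2] -/
def AddCarrier : Type u := AlgebraicClosure k

/-- `K̄` is an abelian group. [folklore] -/
instance AddCarrier.instAddCommGroup : AddCommGroup (AddCarrier k) :=
  inferInstanceAs (AddCommGroup (AlgebraicClosure k))

/-- The discrete topology on the additive carrier. [folklore] -/
instance AddCarrier.instTopologicalSpace : TopologicalSpace (AddCarrier k) := ⊥

/-- The topology on `AddCarrier k` is discrete by definition. [folklore] -/
instance AddCarrier.instDiscreteTopology : DiscreteTopology (AddCarrier k) := ⟨rfl⟩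

variable {k} in
/-- The element of `K̄` underlying an element of the additive carrier (the identity). [folklore] -/
def AddCarrier.val (x : AddCarrier k) : AlgebraicClosure k := x

variable {k} in
/-- View an element of `K̄` in the additive carrier (the identity). [folklore] -/
def AddCarrier.mk (x : AlgebraicClosure k) : AddCarrier k := x

variable {k}

/-- `val (mk x) = x`. [folklore] -/
@[simp] theorem AddCarrier.val_mk (x : AlgebraicClosure k) : (AddCarrier.mk x).val = x := rfl

/-- `mk (val x) = x`. [folklore] -/
@[simp] theorem AddCarrier.mk_val (x : AddCarrier k) : AddCarrier.mk x.val = x := rfl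

/-- `val` is additive. [folklore] -/
@[simp] theorem AddCarrier.val_add (x y : AddCarrier k) : (x + y).val = x.val + y.val := rfl

/-- `val 0 = 0`. [folklore] -/
@[simp] theorem AddCarrier.val_zero : (0 : AddCarrier k).val = 0 := rfl

/-- `val` is injective. [folklore] -/
theorem AddCarrier.val_injective : Function.Injective (AddCarrier.val (k := k)) := fun _ _ h => h

/-- `val` of a finite sum. [folklore] -/
theorem AddCarrier.val_sum {ι : Type*} (s : Finset ι) (f : ι → AddCarrier k) :
    (∑ i ∈ s, f i).val = ∑ i ∈ s, (f i).val := by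
  classical
  induction s using Finset.induction_on with
  | empty => rfl
  | insert i s hi ih => rw [Finset.sum_insert hi, Finset.sum_insert hi, AddCarrier.val_add, ih]

variable (k) in
/-- **The discrete `Γ_k`-module `K̄`** (additive group; `Γ_k` acting through its action on `K̄`,
Mathlib `Representation.ofDistribMulAction`; continuity: stabilisers contain `Gal(K̄/k(x))`,
`setOf_smul_eq_mem_nhds_one`). [cite: SerreGaloisCohomology1997, II §1.2] -/
def addRep : ContinuousRep (absoluteGaloisGroup k) ℤ (AddCarrier k) :=
  ContinuousRep.ofStabilizerMemNhdsOne (M := AddCarrier k)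
    (Representation.ofDistribMulAction ℤ (absoluteGaloisGroup k) (AlgebraicClosure k))
    fun x => setOf_smul_eq_mem_nhds_one k (AddCarrier.val x)

/-- The action of `addRep` is the Galois action. [folklore] -/
@[simp] theorem addRep_apply_val (σ : absoluteGaloisGroup k) (x : AddCarrier k) :
    (addRep k σ x).val = σ • x.val := rfl

end AddRep

/-! ### An element of trace one (Dedekind) and the averaging operator -/

section Trace

variable {k : Type u} [Field k]
variable (H : Subgroup (absoluteGaloisGroup k))
variable (L : IntermediateField k (AlgebraicClosure k)) [FiniteDimensional k L] [IsGalois k L]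

/-- `N = Gal(K̄/L) ∩ H ≤ H`. [folklore] -/
abbrev trN : Subgroup H := (galFixing k L).subgroupOf H

/-- The `H`-module `K̄`. [folklore] -/
abbrev trRep : ContinuousRep H ℤ (AddCarrier k) := (addRep k).restrict (subgroupIncl H)

omit [FiniteDimensional k L] in
/-- `N` is normal in `H` (`Gal(K̄/L) ⊴ Γ_k` for `L/k` Galois). [folklore] -/
theorem normal_trN : (trN H L).Normal :=
  (normal_galFixing L).subgroupOf H

/-- The fixed field `B = K̄^{Gal(K̄/L)}` as a subfield of `K̄` (Mathlib `FixedPoints.subfield`).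
[folklore] -/
abbrev fixedSubfield : Subfield (AlgebraicClosure k) :=
  FixedPoints.subfield (galFixing k L) (AlgebraicClosure k)

omit [FiniteDimensional k L] [IsGalois k L] in
/-- Membership in `fixedSubfield`. [folklore] -/
theorem mem_fixedSubfield_iff (x : AlgebraicClosure k) :
    x ∈ fixedSubfield L ↔ ∀ σ ∈ galFixing k L, σ • x = x :=
  ⟨fun h σ hσ => h ⟨σ, hσ⟩, fun h σ => h σ σ.2⟩

omit [FiniteDimensional k L] [IsGalois k L] in
/-- `L ⊆ K̄^{Gal(K̄/L)}`. [folklore] -/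
theorem le_fixedSubfield (x : AlgebraicClosure k) (hx : x ∈ L) : x ∈ fixedSubfield L :=
  (mem_fixedSubfield_iff L x).2 fun _ hσ => (mem_galFixing_iff k).1 hσ x hx

variable [((trN H L) : Subgroup H).Normal]

omit [FiniteDimensional k L] [IsGalois k L] [((trN H L) : Subgroup H).Normal] in
/-- The invariants `K̄^N` of the `H`-module `K̄` are the elements of `fixedSubfield L`, when
`Gal(K̄/L) ≤ H`. [folklore] -/
theorem mem_invariantsOf_trN_iff (hLH : galFixing k L ≤ H) (x : AddCarrier k) :
    x ∈ (trRep H).invariantsOf (trN H L) ↔ x.val ∈ fixedSubfield L := by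
  rw [ContinuousRep.mem_invariantsOf_iff, mem_fixedSubfield_iff]
  constructor
  · intro h σ hσ
    have h1 := congrArg AddCarrier.val (h ⟨⟨σ, hLH hσ⟩, hσ⟩)
    exact h1
  · rintro h ⟨⟨σ, hσH⟩, hσ⟩
    exact AddCarrier.val_injective (h σ hσ)

omit [FiniteDimensional k L] [IsGalois k L] in
/-- The quotient `H/N` acts on `K̄^N` through representatives. [folklore] -/
theorem quotientInvariants_trN_val (q : H ⧸ trN H L) (w : (trRep H).invariantsOf (trN H L)) :
    (((trRep H).quotientInvariants (trN H L) q w : (trRep H).invariantsOf (trN H L)) :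
      AddCarrier k).val = ((q.out : H) : absoluteGaloisGroup k) • (w : AddCarrier k).val := by
  conv_lhs => rw [← QuotientGroup.out_eq' q]
  rfl

omit [FiniteDimensional k L] [IsGalois k L] in
/-- **An element of trace one** (Dedekind's independence of characters): if `Gal(K̄/L) ≤ H`,
there is `θ ∈ K̄^N`, `N = Gal(K̄/L)`, with `Σ_{q ∈ H/N} q θ = 1`.  The automorphisms of the field
`K̄^N ⊇ L` induced by distinct cosets of `N` in `H` are distinct, hence linearly independent
(`linearIndependent_monoidHom`), so `y ↦ Σ_q q y` is not identically zero on `K̄^N`; its value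
`t ≠ 0` at some `y` is `H`-invariant and `θ = y / t` works.
[cite: SerreLocalFields1979, X §1 Prop. 1] -/
theorem exists_traceOne [Fintype (H ⧸ trN H L)] (hLH : galFixing k L ≤ H) :
    ∃ θ : (trRep H).invariantsOf (trN H L),
      ∑ q : H ⧸ trN H L, (((trRep H).quotientInvariants (trN H L) q θ :
        (trRep H).invariantsOf (trN H L)) : AddCarrier k).val = 1 := by
  classical
  -- the characters of `B = K̄^N` induced by representatives of the cosets
  let χ : H ⧸ trN H L → (fixedSubfield L →* AlgebraicClosure k) := fun q =>
    (MulSemiringAction.toRingHom (absoluteGaloisGroup k) (AlgebraicClosure k)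
      ((q.out : H) : absoluteGaloisGroup k)).toMonoidHom.comp (fixedSubfield L).subtype.toMonoidHom
  have hχ : ∀ (q) (y : fixedSubfield L),
      χ q y = ((q.out : H) : absoluteGaloisGroup k) • (y : AlgebraicClosure k) := fun _ _ => rfl
  have hχinj : Function.Injective χ := by
    intro q q' hqq'
    rw [← QuotientGroup.out_eq' q, ← QuotientGroup.out_eq' q', QuotientGroup.eq,
      Subgroup.mem_subgroupOf, mem_galFixing_iff]
    intro x hx
    have h1 : χ q ⟨x, le_fixedSubfield L x hx⟩ = χ q' ⟨x, le_fixedSubfield L x hx⟩ := by rw [hqq']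
    rw [hχ, hχ] at h1
    change (((q.out : H) : absoluteGaloisGroup k)⁻¹ *
      ((q'.out : H) : absoluteGaloisGroup k)) • x = x
    rw [mul_smul, ← h1, inv_smul_smul]
  -- the sum of the characters is not zero
  have hli := (linearIndependent_monoidHom (fixedSubfield L) (AlgebraicClosure k)).comp χ hχinj
  have hne : ∑ q : H ⧸ trN H L, (χ q : fixedSubfield L → AlgebraicClosure k) ≠ 0 := by
    intro h0
    have h1 := Fintype.linearIndependent_iff.1 hli (fun _ => 1) (by simpa using h0)
      (1 : H ⧸ trN H L)
    exact one_ne_zero h1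
  obtain ⟨y, hy⟩ : ∃ y : fixedSubfield L,
      ∑ q : H ⧸ trN H L, ((q.out : H) : absoluteGaloisGroup k) • (y : AlgebraicClosure k) ≠ 0 := by
    by_contra hall
    simp only [not_exists, not_not] at hall
    apply hne
    ext y
    rw [Finset.sum_apply, Pi.zero_apply]
    simpa only [hχ] using hall y
  -- `t = Σ_q q y` is `H`-invariant
  set t : AlgebraicClosure k :=
    ∑ q : H ⧸ trN H L, ((q.out : H) : absoluteGaloisGroup k) • (y : AlgebraicClosure k) with ht
  have hyN : ∀ n : H, n ∈ trN H L → (n : absoluteGaloisGroup k) • (y : AlgebraicClosure k) = y :=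
    fun n hn => (mem_fixedSubfield_iff L _).1 y.2 _ hn
  have htH : ∀ h : H, (h : absoluteGaloisGroup k) • t = t := by
    intro h
    rw [ht, Finset.smul_sum]
    -- reindex by `q ↦ h q`: `(h * out q) y = out (h q) y` since `(out (h q))⁻¹ * h * out q ∈ N`
    refine Fintype.sum_equiv (Equiv.mulLeft (h : H ⧸ trN H L)) _ _ fun q => ?_
    have hmem : ((((h : H ⧸ trN H L) * q).out)⁻¹ * (h * q.out) : H) ∈ trN H L := by
      rw [← QuotientGroup.eq, QuotientGroup.out_eq', QuotientGroup.mk_mul, QuotientGroup.out_eq']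
    have h2 := hyN _ hmem
    rw [Subgroup.coe_mul, Subgroup.coe_inv, Subgroup.coe_mul, mul_smul, inv_smul_eq_iff,
      mul_smul] at h2
    rw [Equiv.coe_mulLeft]
    exact h2
  have htN : t ∈ fixedSubfield L :=
    (mem_fixedSubfield_iff L t).2 fun σ hσ => htH ⟨σ, hLH hσ⟩
  have ht0 : t ≠ 0 := hy
  -- `θ = y / t`
  have hθmem : t⁻¹ * (y : AlgebraicClosure k) ∈ fixedSubfield L :=
    Subfield.mul_mem _ (Subfield.inv_mem _ htN) y.2
  refine ⟨⟨AddCarrier.mk (t⁻¹ * (y : AlgebraicClosure k)),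
    (mem_invariantsOf_trN_iff H L hLH _).2 hθmem⟩, ?_⟩
  simp only [quotientInvariants_trN_val, AddCarrier.val_mk, smul_mul', smul_inv'', htH,
    ← Finset.mul_sum]
  exact inv_mul_cancel₀ ht0

/-- Multiplication by an element of `K̄^N`, as an additive endomorphism of `K̄^N`. [folklore] -/
def mulLeftInv (hLH : galFixing k L ≤ H) (θ : (trRep H).invariantsOf (trN H L)) :
    (trRep H).invariantsOf (trN H L) →+ (trRep H).invariantsOf (trN H L) where
  toFun w := ⟨AddCarrier.mk ((θ : AddCarrier k).val * (w : AddCarrier k).val),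
    (mem_invariantsOf_trN_iff H L hLH _).2 (by
      rw [AddCarrier.val_mk]
      exact Subfield.mul_mem _ ((mem_invariantsOf_trN_iff H L hLH _).1 θ.2)
        ((mem_invariantsOf_trN_iff H L hLH _).1 w.2))⟩
  map_zero' := by
    apply Subtype.ext
    apply AddCarrier.val_injective
    simp
  map_add' w w' := by
    apply Subtype.ext
    apply AddCarrier.val_injective
    simp [mul_add]

omit [FiniteDimensional k L] [IsGalois k L] [((trN H L) : Subgroup H).Normal] in
/-- `mulLeftInv` on elements. [folklore] -/
@[simp] theorem mulLeftInv_val (hLH : galFixing k L ≤ H) (θ w : (trRep H).invariantsOf (trN H L)) :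
    ((mulLeftInv H L hLH θ w : (trRep H).invariantsOf (trN H L)) : AddCarrier k).val =
      (θ : AddCarrier k).val * (w : AddCarrier k).val := rfl

omit [FiniteDimensional k L] [IsGalois k L] in
/-- **The averaging hypothesis holds for `K̄^N` with `λ = θ ·`, `θ` of trace one**:
`Σ_m m(θ · m⁻¹ a) = (Σ_m m θ) a = a`. [cite: SerreLocalFields1979, VIII §1] -/
theorem avgFun_mulLeftInv_eq [Fintype (H ⧸ trN H L)] (hLH : galFixing k L ≤ H)
    (θ : (trRep H).invariantsOf (trN H L))
    (hθ : ∑ q : H ⧸ trN H L, (((trRep H).quotientInvariants (trN H L) q θ :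
      (trRep H).invariantsOf (trN H L)) : AddCarrier k).val = 1)
    (a : (trRep H).invariantsOf (trN H L)) :
    avgFun ((trRep H).quotientInvariants (trN H L)) (mulLeftInv H L hLH θ) (fun _ => a) = a := by
  apply Subtype.ext
  apply AddCarrier.val_injective
  unfold avgFun
  rw [Submodule.coe_sum, AddCarrier.val_sum]
  have hterm : ∀ m : H ⧸ trN H L,
      (((trRep H).quotientInvariants (trN H L) m
        (mulLeftInv H L hLH θ (((trRep H).quotientInvariants (trN H L) m⁻¹) a)) :
        (trRep H).invariantsOf (trN H L)) : AddCarrier k).val =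
      (((trRep H).quotientInvariants (trN H L) m θ : (trRep H).invariantsOf (trN H L)) :
        AddCarrier k).val * (a : AddCarrier k).val := by
    intro m
    have hback : (trRep H).quotientInvariants (trN H L) m
        (((trRep H).quotientInvariants (trN H L) m⁻¹) a) = a := by
      rw [← Module.End.mul_apply, ← map_mul, mul_inv_cancel, map_one, Module.End.one_apply]
    have hback' :=
      congrArg (fun (w : (trRep H).invariantsOf (trN H L)) => (w : AddCarrier k).val) hback
    simp only [quotientInvariants_trN_val, mulLeftInv_val, smul_mul'] at hback' ⊢
    rw [hback']
  simp only [hterm, ← Finset.sum_mul, hθ, one_mul]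

end Trace

/-! ### Vanishing in degrees one and two -/

section Vanishing

variable {k : Type u} [Field k]

/-- Data attached to an open subgroup `H` and a neighbourhood `W` of `1`: a finite Galois `L/k`
with `Gal(K̄/L) ≤ H` and `Gal(K̄/L) ⊆ W`. [folklore] -/
theorem exists_galFixing_le_subset (H : Subgroup (absoluteGaloisGroup k))
    (hH : IsOpen (H : Set (absoluteGaloisGroup k))) {W : Set (absoluteGaloisGroup k)}
    (hW : W ∈ 𝓝 (1 : absoluteGaloisGroup k)) :
    ∃ L : IntermediateField k (AlgebraicClosure k), FiniteDimensional k L ∧ IsGalois k L ∧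
      galFixing k L ≤ H ∧ (galFixing k L : Set (absoluteGaloisGroup k)) ⊆ W := by
  obtain ⟨L, hfin, hgal, hL⟩ := exists_finiteDimensional_isGalois_galFixing_subset (k := k)
    (inter_mem hW (hH.mem_nhds H.one_mem))
  exact ⟨L, hfin, hgal, fun σ hσ => (hL hσ).2, fun σ hσ => (hL hσ).1⟩

variable (H : Subgroup (absoluteGaloisGroup k))
  (L : IntermediateField k (AlgebraicClosure k)) [FiniteDimensional k L] [IsGalois k L]

omit [IsGalois k L] in
/-- `N = Gal(K̄/L) ∩ H` is open in `H`. [folklore] -/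
theorem isOpen_trN : IsOpen ((trN H L : Subgroup H) : Set H) := by
  change IsOpen ((Subtype.val : H → absoluteGaloisGroup k) ⁻¹' (galFixing k L))
  exact (isOpen_galFixing k L).preimage continuous_subtype_val

omit [FiniteDimensional k L] [IsGalois k L] in
/-- `N = Gal(K̄/L) ∩ H` is closed in `H`. [folklore] -/
theorem isClosed_trN : IsClosed ((trN H L : Subgroup H) : Set H) := by
  change IsClosed ((Subtype.val : H → absoluteGaloisGroup k) ⁻¹' (galFixing k L))
  exact (isClosed_galFixing k L).preimage continuous_subtype_val

/-- **`H¹(H, K̄) = 0` for every open subgroup `H ≤ Γ_k`** (additive Hilbert 90, Serre II §1.2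
Prop. 1 for `q = 1`, for the profinite groups `Gal(K̄/F)`, `F/k` finite separable).
[cite: SerreGaloisCohomology1997, II §1.2 Prop. 1] [cite: SerreLocalFields1979, X §1 Prop. 1] -/
theorem subsingleton_one_addRep (hH : IsOpen (H : Set (absoluteGaloisGroup k))) :
    Subsingleton (continuousCohomology 1 ((addRep k).restrict (subgroupIncl H)).toTopRep) := by
  classical
  haveI := absoluteGaloisGroup_compactSpace k
  haveI : IsClosed (H : Set (absoluteGaloisGroup k)) := Subgroup.isClosed_of_isOpen H hH
  refine (subsingleton_homology_succ_iff _ 0).2 fun z hz => ?_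
  have hz1 : (homogeneousCochains ((addRep k).restrict (subgroupIncl H)).toTopRep).d 1 2 z = 0 := hz
  -- `z` dies on a small `Gal(K̄/L)`
  obtain ⟨V, hV, hVres⟩ := exists_nhds_one_res_one_eq_zero ((addRep k).restrict (subgroupIncl H))
    z hz1
  obtain ⟨W, hW, hWV⟩ := (mem_nhds_subtype _ (1 : H) V).1 hV
  obtain ⟨L, hfin, hgal, hLH, hLW⟩ := exists_galFixing_le_subset H hH hW
  haveI := hfin
  haveI := hgal
  haveI : (trN H L).Normal := normal_trN H L
  haveI : IsClosed ((trN H L : Subgroup H) : Set H) := isClosed_trN H L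
  have hsub : (((trN H L) : Subgroup H) : Set H) ⊆ V := fun x hx => hWV (hLW hx)
  have hres0 := hVres (trN H L) hsub
  -- the finite quotient and the averaging
  haveI : DiscreteTopology (H ⧸ trN H L) := QuotientGroup.discreteTopology (isOpen_trN H L)
  haveI : Finite (H ⧸ trN H L) := Subgroup.quotient_finite_of_isOpen _ (isOpen_trN H L)
  letI : Fintype (H ⧸ trN H L) := Fintype.ofFinite _
  obtain ⟨θ, hθ⟩ := exists_traceOne H L hLH
  have hQ : Subsingleton (continuousCohomology 1
      (((addRep k).restrict (subgroupIncl H)).quotientInvariants (trN H L)).toTopRep) :=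
    subsingleton_continuousCohomology_one_of_avg_eq _ (mulLeftInv H L hLH θ)
      (avgFun_mulLeftInv_eq H L hLH θ hθ)
  obtain ⟨e, he⟩ := exists_d_eq_of_res_eq_d_one (trN H L) ((addRep k).restrict (subgroupIncl H))
    hQ z hz1 ⟨0, by rw [map_zero]; exact hres0.symm⟩
  exact ⟨e, he⟩

/-- **`H²(H, K̄) = 0` for every open subgroup `H ≤ Γ_k`** (Serre II §1.2 Prop. 1 for `q = 2`).
[cite: SerreGaloisCohomology1997, II §1.2 Prop. 1] [cite: SerreLocalFields1979, X §1 Prop. 1] -/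
theorem subsingleton_two_addRep (hH : IsOpen (H : Set (absoluteGaloisGroup k))) :
    Subsingleton (continuousCohomology 2 ((addRep k).restrict (subgroupIncl H)).toTopRep) := by
  classical
  haveI := absoluteGaloisGroup_compactSpace k
  haveI : IsClosed (H : Set (absoluteGaloisGroup k)) := Subgroup.isClosed_of_isOpen H hH
  refine (subsingleton_homology_succ_iff _ 1).2 fun a ha => ?_
  have ha2 : (homogeneousCochains ((addRep k).restrict (subgroupIncl H)).toTopRep).d 2 3 a = 0 := ha
  obtain ⟨V, hV, hVres⟩ := exists_nhds_one_res_two_eq_d ((addRep k).restrict (subgroupIncl H)) a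
  obtain ⟨W, hW, hWV⟩ := (mem_nhds_subtype _ (1 : H) V).1 hV
  obtain ⟨L, hfin, hgal, hLH, hLW⟩ := exists_galFixing_le_subset H hH hW
  haveI := hfin
  haveI := hgal
  haveI : (trN H L).Normal := normal_trN H L
  haveI : IsClosed ((trN H L : Subgroup H) : Set H) := isClosed_trN H L
  have hsub : (((trN H L) : Subgroup H) : Set H) ⊆ V := fun x hx => hWV (hLW hx)
  have hres := hVres (trN H L) hsub
  haveI : DiscreteTopology (H ⧸ trN H L) := QuotientGroup.discreteTopology (isOpen_trN H L)
  haveI : Finite (H ⧸ trN H L) := Subgroup.quotient_finite_of_isOpen _ (isOpen_trN H L)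
  letI : Fintype (H ⧸ trN H L) := Fintype.ofFinite _
  obtain ⟨θ, hθ⟩ := exists_traceOne H L hLH
  -- `H¹(N, K̄) = 0`: `N ≅ Gal(K̄/L)` is open in `Γ_k`
  have h1 : Subsingleton (continuousCohomology 1
      ((((addRep k).restrict (subgroupIncl H)).restrict (subgroupIncl (trN H L))).toTopRep)) :=
    (subsingleton_iff_of_continuousMulEquiv (Subgroup.subgroupOfContinuousMulEquivOfLe hLH)
      ((addRep k).restrict (subgroupIncl (galFixing k L)))
      (((addRep k).restrict (subgroupIncl H)).restrict (subgroupIncl (trN H L)))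
      (fun _ _ => rfl) 1).1 (subsingleton_one_addRep (galFixing k L) (isOpen_galFixing k L))
  -- `H²(H/N, K̄^N) = 0` by averaging
  have h2 : Subsingleton (continuousCohomology 2
      (((addRep k).restrict (subgroupIncl H)).quotientInvariants (trN H L)).toTopRep) :=
    subsingleton_continuousCohomology_two_of_avg_eq _ (mulLeftInv H L hLH θ)
      (avgFun_mulLeftInv_eq H L hLH θ hθ)
  obtain ⟨b, hb⟩ := exists_d_eq_of_res_eq_d_two (trN H L) ((addRep k).restrict (subgroupIncl H))
    h1 h2 a ha2 hres
  exact ⟨b, hb⟩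

end Vanishing

end Literature.NumberTheory.GaloisRepresentations

end
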